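import Mathlib
import Summits.NavierStokesRegularity.NavierStokesRegularity.Theorems.FilamentSkeletonRssClause13NearStraightKernel

/-!
# Clause 13 dictionary (c1), bookkeeping on the window: rigid cores are CONSTANT on the unit-speed window of an in-ball station, and the matched
# kernels along a near-straight filament are dominated by the model kernels (`K₅ ≤ 32·k₅`) and by `8|τ−σ|⁻³` in the tail
# (line `rate_bordered_split` of crux `Clause13RNearStraightL`, stmt-NavierStokesRegularity-23612; item 1b of DIAG-23612-rate-row-leafhand3-g0 §4/§6)

Route `FilamentSkeletonRss`, Variant A1R.  Companion of `…Clause13NearStraightKernel` (p822532).  Three facts every (c1) remainder estimate uses: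

* `core_eq_on_window` — clause 13 (rigid matched cores: `‖X_j σ‖ ≤ 2R_b√(Γ log Γ) → Aa_j σ = Aa_j(c_j)`) + unit speed: at an in-ball station `τ`
  (`‖X_j τ‖ ≤ R_b√(Γ log Γ)`) the core is the constant `Aa_j(c_j)` on the whole parameter window `|σ − τ| ≤ R_b√(Γ log Γ)` — so on that window the
  self-term kernel of `DT·Y` IS the constant-core Rosenhead kernel of the MODEL files;
* `kernel5_le_model` — `((‖X τ − X σ‖² + q)^{5/2})⁻¹ ≤ 32·(((τ−σ)² + q)^{5/2})⁻¹` for tangent oscillation `R_b ≤ 1/2` (the `K₅` factor of the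
  kernel-derivative part, which vanishes on the straight model and is a remainder along the actual filament);
* `kernel3_le_tail` — `((‖X τ − X σ‖² + q)^{3/2})⁻¹ ≤ 8·|τ − σ|⁻³` for `R_b ≤ 1/2`, `τ ≠ σ` (tail of the self term beyond the window, any core `q ≥ 0`).

Hand `leafhand-ns-filamentskeletonrs-3-g0` (LAND-ONLY); `--supports stmt-NavierStokesRegularity-23612 --as helper`.  HONEST FRAMING: elementary estimates for a
HYPOTHETICAL near-straight filament skeleton on the NEGATIVE side of a MODEL blow-up route; nothing here bears on Navier–Stokes regularity or blow-up; neither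
stub is proved here.
-/

noncomputable section

open Real
open Summit.NavierStokesRegularity.NavierStokesRegularity.Theorems.Clause13NearStraightKernel (norm_chord_le norm_chord_ge)

namespace Summit.NavierStokesRegularity.NavierStokesRegularity.Theorems.Clause13NearStraightWindow
set_option linter.dupNamespace false

/-- **Rigid core on the window of an in-ball station.**  If `Aa σ = Aa c` whenever `‖X σ‖ ≤ 2R_b√(Γ log Γ)` (clause 13), `X` has unit speed, and
`‖X τ‖ ≤ R_b√(Γ log Γ)` (in-ball station), then `Aa σ = Aa c` for all `|σ − τ| ≤ R_b√(Γ log Γ)`. [folklore] -/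
theorem core_eq_on_window {X : ℝ → EuclideanSpace ℝ (Fin 3)} {Aa : ℝ → ℝ} {Rb Γ c : ℝ} (hX : Differentiable ℝ X)
    (hunit : ∀ σ, ‖deriv X σ‖ = 1)
    (hcore : ∀ σ, ‖X σ‖ ≤ 2 * Rb * Real.sqrt (Γ * Real.log Γ) → Aa σ = Aa c)
    {τ σ : ℝ} (hin : ‖X τ‖ ≤ Rb * Real.sqrt (Γ * Real.log Γ)) (hσ : |σ - τ| ≤ Rb * Real.sqrt (Γ * Real.log Γ)) :
    Aa σ = Aa c := by
  apply hcore σ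
  have h := norm_chord_le hX hunit σ τ
  calc ‖X σ‖ = ‖X τ + (X σ - X τ)‖ := by rw [add_sub_cancel]
    _ ≤ ‖X τ‖ + ‖X σ - X τ‖ := norm_add_le _ _
    _ ≤ Rb * Real.sqrt (Γ * Real.log Γ) + Rb * Real.sqrt (Γ * Real.log Γ) := add_le_add hin (h.trans hσ)
    _ = 2 * Rb * Real.sqrt (Γ * Real.log Γ) := by ring

/-- **`K₅` along the filament vs the model**: `((‖X τ − X σ‖² + q)^{5/2})⁻¹ ≤ 32·(((τ−σ)² + q)^{5/2})⁻¹` for `R_b ≤ 1/2`, `q > 0`. [folklore] -/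
theorem kernel5_le_model {X : ℝ → EuclideanSpace ℝ (Fin 3)} {Rb q : ℝ} (hX : Differentiable ℝ X) (hunit : ∀ σ, ‖deriv X σ‖ = 1)
    (hns : ∀ τ σ, ‖deriv X τ - deriv X σ‖ ≤ Rb) (hRb : Rb ≤ 1 / 2) (hq : 0 < q) (τ σ : ℝ) :
    ((‖X τ - X σ‖ ^ 2 + q) ^ (5 / 2 : ℝ))⁻¹ ≤ 32 * (((τ - σ) ^ 2 + q) ^ (5 / 2 : ℝ))⁻¹ := by
  have h1Rb : (1:ℝ) / 2 ≤ 1 - Rb := by linarith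
  set A := ‖X τ - X σ‖ ^ 2 + q with hA_def
  set B := (τ - σ) ^ 2 + q with hB_def
  have hA : 0 < A := by positivity
  have hB : 0 < B := by positivity
  -- B/4 ≤ A
  have hlow : B / 4 ≤ A := by
    have hc := norm_chord_ge hX hunit hns τ σ
    have hc' : (1:ℝ) / 2 * |τ - σ| ≤ ‖X τ - X σ‖ := le_trans (mul_le_mul_of_nonneg_right h1Rb (abs_nonneg _)) hc
    have hc2 : ((1:ℝ) / 2 * |τ - σ|) ^ 2 ≤ ‖X τ - X σ‖ ^ 2 := pow_le_pow_left₀ (by positivity) hc' 2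
    rw [mul_pow, sq_abs] at hc2
    rw [hA_def, hB_def]
    nlinarith
  -- A^{-5/2} ≤ (B/4)^{-5/2} = 32 B^{-5/2}
  have hpow : (A ^ (5 / 2 : ℝ))⁻¹ ≤ ((B / 4) ^ (5 / 2 : ℝ))⁻¹ := by
    apply inv_anti₀ (Real.rpow_pos_of_pos (by positivity) _)
    exact Real.rpow_le_rpow (by positivity) hlow (by norm_num)
  have h4 : (4:ℝ) ^ (5 / 2 : ℝ) = 32 := by
    rw [show (4:ℝ) = 2 ^ ((2:ℕ):ℝ) by norm_num, ← Real.rpow_mul (by norm_num),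
      show ((2:ℕ):ℝ) * (5 / 2 : ℝ) = ((5:ℕ):ℝ) by norm_num, Real.rpow_natCast]
    norm_num
  have hsplit : ((B / 4) ^ (5 / 2 : ℝ))⁻¹ = 32 * (B ^ (5 / 2 : ℝ))⁻¹ := by
    rw [Real.div_rpow hB.le (by norm_num : (0:ℝ) ≤ 4), inv_div, h4, div_eq_mul_inv]
  rw [← hsplit]; exact hpow

/-- **Tail bound for `K₃` along the filament**: `((‖X τ − X σ‖² + q)^{3/2})⁻¹ ≤ 8·(|τ − σ|^3)⁻¹` for `R_b ≤ 1/2`, `q ≥ 0`, `τ ≠ σ`. [folklore] -/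
theorem kernel3_le_tail {X : ℝ → EuclideanSpace ℝ (Fin 3)} {Rb q : ℝ} (hX : Differentiable ℝ X) (hunit : ∀ σ, ‖deriv X σ‖ = 1)
    (hns : ∀ τ σ, ‖deriv X τ - deriv X σ‖ ≤ Rb) (hRb : Rb ≤ 1 / 2) (hq : 0 ≤ q) {τ σ : ℝ} (hne : τ ≠ σ) :
    ((‖X τ - X σ‖ ^ 2 + q) ^ (3 / 2 : ℝ))⁻¹ ≤ 8 * (|τ - σ| ^ 3)⁻¹ := by
  have h1Rb : (1:ℝ) / 2 ≤ 1 - Rb := by linarith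
  have hs : 0 < |τ - σ| := abs_pos.2 (sub_ne_zero.2 hne)
  have hc := norm_chord_ge hX hunit hns τ σ
  have hc' : |τ - σ| / 2 ≤ ‖X τ - X σ‖ := by
    have := mul_le_mul_of_nonneg_right h1Rb (abs_nonneg (τ - σ)); linarith
  have hpos : 0 < (|τ - σ| / 2) ^ 2 := by positivity
  -- (‖Δ‖² + q)^{3/2} ≥ ((|τ−σ|/2)²)^{3/2} = |τ−σ|³/8
  have hlow : (|τ - σ| / 2) ^ 2 ≤ ‖X τ - X σ‖ ^ 2 + q := by
    have := pow_le_pow_left₀ (by positivity) hc' 2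
    linarith
  have hpow : ((‖X τ - X σ‖ ^ 2 + q) ^ (3 / 2 : ℝ))⁻¹ ≤ (((|τ - σ| / 2) ^ 2) ^ (3 / 2 : ℝ))⁻¹ := by
    apply inv_anti₀ (Real.rpow_pos_of_pos hpos _)
    exact Real.rpow_le_rpow hpos.le hlow (by norm_num)
  have hval : (((|τ - σ| / 2) ^ 2) ^ (3 / 2 : ℝ))⁻¹ = 8 * (|τ - σ| ^ 3)⁻¹ := by
    have h2 : ((|τ - σ| / 2) ^ 2) ^ (3 / 2 : ℝ) = (|τ - σ| / 2) ^ (3:ℕ) := by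
      rw [← Real.rpow_natCast (|τ - σ| / 2) 2, ← Real.rpow_mul (by positivity),
        show ((2:ℕ):ℝ) * (3 / 2 : ℝ) = ((3:ℕ):ℝ) by norm_num, Real.rpow_natCast]
    rw [h2, div_pow, inv_div, div_eq_mul_inv]
    norm_num
  rw [← hval]; exact hpow

end Summit.NavierStokesRegularity.NavierStokesRegularity.Theorems.Clause13NearStraightWindow

end
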